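import Mathlib
import HarnessLib
import Summits.AtomisticToContinuum.Crystallization.Theorems.PricedLinkCensusSoftFourRingsRigFinal

/-!
# Soft four-rings certified numerics, PAIR-TARGET extension (1): rows, checker, box soundness
# (decomp-a2c, lens 3, gen 32 — the `P`-route engine for `CapForcing (1/100)`)

The `Rig` engine (`…RigRows` … `…RigFinal`) certifies, cell by cell, that every feasible labelled
configuration is `6/25`-close to a rotated pattern (terminal `objective` instruction).  The `P` side
of the `FrustratedLawDichotomy` cut (`SphericalPairBound`, file `…SphericalPairBound`) asks instead
for a PAIR INEQUALITY `⟪p a, p b⟫ < C / S²` for a fixed labelled pair `(a, b)`.  This is certified by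
the SAME replay with ONE new ingredient and one removed:

* a TARGET `(a, b, C)` contributes, once both points are placed, the extra LP row
  `-Σ pairCoeff · d ≤ (-C + c0 + rem)/S` — the linearisation of the NEGATED goal `C ≤ S²·(x a ⬝ x b)`
  (exactly the lower-bond row of `pairRows` with `CBLO2 ↦ C`), appended AFTER the canonical rows
  (`rowsOfT = rowsOf ++ targetRows`, so canonical row indices are unchanged);
* the `objective` instruction is rejected: every branch of every cell must end PRUNED
  (`runInstrsT`), so a passing check refutes the negated goal outright.

This file: the definitions (`PairTarget`, `targetRows`, `rowsOfT`, `applyBoundT`, `stepInstrT`,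
`runInstrsT`, `runCellT`, `checkAllT`, all computable, same certificate/stream format as `…RigCell`)
and the box-level soundness (`targetRow_holds`, `rowsT_hold`, `applyBoundT_sound`, `pruneT_sound`).
The replay induction and the wrapper to twelve unit vectors are in `…RigPairsSound`.
`[folklore]`; no `sorry`; no `instance`/`notation`; no data.
-/

namespace Summit.AtomisticToContinuum.Crystallization.Theorems

namespace Rig

open Literature.Analysis.ValidatedNumerics.NumericsMP
open scoped Matrix

/-! ### Targets and their rows -/

/-- A pair target: the negated goal `C ≤ S²·⟪x a, x b⟫` to be refuted. -/
structure PairTarget where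
  /-- first label -/
  a : Fin 12
  /-- second label -/
  b : Fin 12
  /-- scaled level (`S²`-units) -/
  C : ℤ


/-- The LP row of a target (linearised negated goal; cf. the lower bond row of `pairRows`). -/
def targetRow (bx : Boxes) (t : PairTarget) : Row :=
  ⟨fun v k => -pairCoeff bx t.a t.b v k, -t.C + c0 bx t.a t.b + rem bx t.a t.b⟩

/-- The target rows of the current boxes (a target contributes once both points are placed). -/
def targetRows (T : List PairTarget) (bx : Boxes) : List Row :=
  T.flatMap fun t => if bx.placed t.a && bx.placed t.b then [targetRow bx t] else []

/-- **The extended canonical row list**: canonical rows first (indices unchanged), then targets. -/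
def rowsOfT (bond : Fin 12 → Fin 12 → Bool) (T : List PairTarget) (bx : Boxes) : List Row :=
  rowsOf bond bx ++ targetRows T bx

/-! ### The checker -/

/-- Apply a bound instruction against the extended rows. -/
def applyBoundT (m : Model) (T : List PairTarget) (bx : Boxes) (st : List Step) (v : Fin 12) (k : Fin 3)
    (up : Bool) (cert : Cert) : Outcome :=
  match bx v with
  | none => Outcome.failed
  | some B =>
    let rows := (rowsOfT m.bond T bx).toArray
    let U := certUpper bx rows (unitObj v k up) cert
    let I := B.get k
    let C := bx.C v k
    let I' : MI := if up then ⟨I.lo, min I.hi (C + U)⟩ else ⟨max I.lo (C - U), I.hi⟩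
    if I'.hi < I'.lo then Outcome.pruned
    else Outcome.running (Function.update bx v (some (B.setCoord k I'))) st

/-- One non-branching instruction; `objective` is not admissible in a pair check. -/
def stepInstrT (m : Model) (T : List PairTarget) (bx : Boxes) (st : List Step) : Instr → Outcome
  | Instr.bound v k up cert => applyBoundT m T bx st v k up cert
  | Instr.prune terms =>
      if certInfeasible bx (rowsOfT m.bond T bx).toArray terms then Outcome.pruned else Outcome.failed
  | Instr.place _ _ => Outcome.failed
  | Instr.objective _ _ _ _ _ _ => Outcome.failed

/-- Replay an instruction stream against the extended rows (same nesting discipline as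
`runInstrs`; success only by pruning). -/
def runInstrsT (m : Model) (T : List PairTarget) : Boxes → List Step → List Instr → Bool
  | _, _, [] => false
  | bx, st, Instr.place terms n :: is =>
    match placeBoxes bx st with
    | none => false
    | some (v, main, alt, rest) =>
      let bxAlt : Boxes := Function.update bx v (some alt)
      let altOK := if certInfeasible bxAlt (rowsOfT m.bond T bxAlt).toArray terms then true
        else runInstrsT m T bxAlt rest (is.take n)
      altOK && runInstrsT m T (Function.update bx v (some main)) rest (is.drop n)
  | bx, st, i :: is =>
    match stepInstrT m T bx st i with
    | Outcome.pruned => true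
    | Outcome.verified => false
    | Outcome.failed => false
    | Outcome.running bx' st' => runInstrsT m T bx' st' is
termination_by _ _ is => is.length

/-- **The pair-target cell checker.** -/
def runCellT (m : Model) (T : List PairTarget) (c : Cell) : Bool :=
  match initBoxes m c with
  | none => false
  | some none => true
  | some (some bx) => runInstrsT m T bx m.steps c.instrs

/-- **The pair-target check**: both charts covered and every cell pruned. -/
def checkAllT (m : Model) (T : List PairTarget) (cells : List Cell) : Bool :=
  coversChart cells true && coversChart cells false && cells.all (runCellT m T)

/-! ### Soundness of the target rows -/

/-- The (negated-goal) hypotheses of a target list for a configuration `x`. -/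
def TargetsHold (T : List PairTarget) (x : Fin 12 → Fin 3 → ℝ) : Prop :=
  ∀ t ∈ T, (t.C : ℝ) ≤ (SC : ℝ) * SC * (x t.a ⬝ᵥ x t.b)

/-- A target row holds for the displacement of a configuration satisfying the negated goal. -/
theorem targetRow_holds {bx : Boxes} {x : Fin 12 → Fin 3 → ℝ} {t : PairTarget}
    (hT : (t.C : ℝ) ≤ (SC : ℝ) * SC * (x t.a ⬝ᵥ x t.b)) (hx : bx.mem x)
    (ha : bx.placed t.a = true) (hb : bx.placed t.b = true) :
    (targetRow bx t).Holds (bx.disp x) := by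
  have hS : (0 : ℝ) < SC := by exact_mod_cast SC_pos
  have hd := Boxes.dispIn_of_mem hx
  have hexp := inner_expand (x := x) ha hb
  have hremge := le_rem hd t.a t.b
  unfold Row.Holds targetRow
  have hneg : (∑ v, ∑ k, ((-pairCoeff bx t.a t.b v k : ℤ) : ℝ) * bx.disp x v k) =
      -∑ v, ∑ k, (pairCoeff bx t.a t.b v k : ℝ) * bx.disp x v k := by
    push_cast
    simp only [neg_mul, Finset.sum_neg_distrib]
  rw [hneg, sum_pairCoeff, le_div_iff₀ hS]
  push_cast
  nlinarith [hexp, hT, hremge]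

/-- Every target row holds. -/
theorem targetRows_hold {T : List PairTarget} {bx : Boxes} {x : Fin 12 → Fin 3 → ℝ}
    (hT : TargetsHold T x) (hx : bx.mem x) : ∀ r ∈ targetRows T bx, r.Holds (bx.disp x) := by
  intro r hr
  unfold targetRows at hr
  rw [List.mem_flatMap] at hr
  obtain ⟨t, ht, hr⟩ := hr
  by_cases hpl : (bx.placed t.a && bx.placed t.b) = true
  · rw [if_pos hpl] at hr
    simp only [List.mem_cons, List.mem_nil_iff, or_false] at hr
    subst hr
    rw [Bool.and_eq_true] at hpl
    exact targetRow_holds (hT t ht) hx hpl.1 hpl.2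
  · rw [if_neg hpl] at hr; exact absurd hr (by simp)

/-- **Every extended row holds** for a feasible configuration satisfying the negated goals. -/
theorem rowsT_hold {bond : Fin 12 → Fin 12 → Bool} {T : List PairTarget} {bx : Boxes}
    {x : Fin 12 → Fin 3 → ℝ} (hF : Feasible bond x) (hT : TargetsHold T x) (hx : bx.mem x) :
    ∀ r ∈ rowsOfT bond T bx, r.Holds (bx.disp x) := by
  intro r hr
  unfold rowsOfT at hr
  rw [List.mem_append] at hr
  rcases hr with hr | hr
  · exact rows_hold hF hx r hr
  · exact targetRows_hold hT hx r hr

/-! ### Soundness of the box-transforming instructions -/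

/-- **Soundness of `applyBoundT`** (as `applyBound_sound`, against the extended rows). -/
theorem applyBoundT_sound {m : Model} {T : List PairTarget} {x : Fin 12 → Fin 3 → ℝ}
    (hF : Feasible m.bond x) (hT : TargetsHold T x) {bx : Boxes} (hx : bx.mem x) (st : List Step)
    (v : Fin 12) (k : Fin 3) (up : Bool) (cert : Cert) :
    applyBoundT m T bx st v k up cert ≠ Outcome.pruned ∧
    ∀ bx' st', applyBoundT m T bx st v k up cert = Outcome.running bx' st' → bx'.mem x ∧ st' = st := by
  have hS : (0 : ℝ) < SC := by exact_mod_cast SC_pos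
  unfold applyBoundT
  cases hv : bx v with
  | none => simp
  | some B =>
    simp only
    have hrows : ∀ r ∈ (rowsOfT m.bond T bx).toArray, r.Holds (bx.disp x) := by
      intro r hr; exact rowsT_hold hF hT hx r (List.mem_toArray.1 hr)
    have hd := Boxes.dispIn_of_mem hx
    have hU := certUpper_sound hrows hd (unitObj v k up) cert
    rw [sum_unitObj] at hU
    set U := certUpper bx (rowsOfT m.bond T bx).toArray (unitObj v k up) cert
    have hplaced : bx.placed v = true := by simp [Boxes.placed, hv]
    have hdisp : bx.disp x v k = x v k - bx.c v k := by simp [Boxes.disp, hplaced]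
    have hxk := hx v B hv k
    rw [← Boxes.ivl_of_some hv k] at hxk
    obtain ⟨hlo, hhi⟩ := hxk
    have hwin : (if up then x v k * SC ≤ (bx.C v k : ℝ) + U
        else (bx.C v k : ℝ) - U ≤ x v k * SC) := by
      unfold Boxes.c at hdisp
      cases up with
      | true =>
        simp only [if_true, one_mul] at hU ⊢
        rw [hdisp, le_div_iff₀ hS] at hU
        have : (x v k - (bx.C v k : ℝ) / SC) * SC = x v k * SC - bx.C v k := by field_simp
        linarith [hU, this]
      | false =>
        simp only [Bool.false_eq_true, if_false, neg_one_mul] at hU ⊢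
        rw [hdisp, le_div_iff₀ hS] at hU
        have : -(x v k - (bx.C v k : ℝ) / SC) * SC = -(x v k * SC) + bx.C v k := by
          field_simp; ring
        linarith [hU, this]
    set I' : MI := if up then ⟨(B.get k).lo, min (B.get k).hi (bx.C v k + U)⟩
      else ⟨max (B.get k).lo (bx.C v k - U), (B.get k).hi⟩ with hI'
    have hmemI' : MI.mem SC (x v k) I' := by
      rw [Boxes.ivl_of_some hv k] at hlo hhi
      cases up with
      | true =>
        simp only [if_true] at hwin hI'
        rw [hI']
        refine ⟨hlo, ?_⟩
        push_cast
        exact le_min hhi hwin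
      | false =>
        simp only [Bool.false_eq_true, if_false] at hwin hI'
        rw [hI']
        refine ⟨?_, hhi⟩
        push_cast
        exact max_le hlo hwin
    constructor
    · intro hpr
      by_cases hlt : I'.hi < I'.lo
      · have h1 := hmemI'.1; have h2 := hmemI'.2
        have : (I'.hi : ℝ) < I'.lo := by exact_mod_cast hlt
        linarith
      · rw [if_neg hlt] at hpr; exact absurd hpr (by simp)
    · intro bx' st' hrun
      by_cases hlt : I'.hi < I'.lo
      · rw [if_pos hlt] at hrun; exact absurd hrun (by simp)
      · rw [if_neg hlt] at hrun
        simp only [Outcome.running.injEq] at hrun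
        obtain ⟨rfl, rfl⟩ := hrun
        refine ⟨mem_update hx v ?_, rfl⟩
        intro l
        simp only [IVec.setCoord, IVec.get_ofFn]
        by_cases hl : l = k
        · subst hl; rw [if_pos rfl]; exact hmemI'
        · rw [if_neg hl]; exact hx v B hv l

/-- `applyBoundT` never reports `verified`. -/
theorem applyBoundT_ne_verified (m : Model) (T : List PairTarget) (bx : Boxes) (st : List Step)
    (v : Fin 12) (k : Fin 3) (up : Bool) (cert : Cert) :
    applyBoundT m T bx st v k up cert ≠ Outcome.verified := by
  unfold applyBoundT
  cases bx v with
  | none => simp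
  | some B => simp only; split_ifs <;> simp

/-- **Soundness of `prune`** against the extended rows. -/
theorem pruneT_sound {m : Model} {T : List PairTarget} {x : Fin 12 → Fin 3 → ℝ} (hF : Feasible m.bond x)
    (hT : TargetsHold T x) {bx : Boxes} (hx : bx.mem x) (terms : List (ℕ × ℕ)) :
    certInfeasible bx (rowsOfT m.bond T bx).toArray terms = false := by
  by_contra h
  rw [Bool.not_eq_false] at h
  exact certInfeasible_sound (fun r hr => rowsT_hold hF hT hx r (List.mem_toArray.1 hr))
    (Boxes.dispIn_of_mem hx) h

end Rig

end Summit.AtomisticToContinuum.Crystallization.Theorems
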